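import Summits.AnomalousDissipation.AnomalousDissipation.Theorems.SawtoothPulseCascadeK1LocalisedCascadeZoneJunk

/-!
# K1loc, line `Spectral` — S-D (first good piece): THE ZONE-VISITOR SET HAS MEASURE AT MOST THE SUM OF THE ZONES

Helper file of the prover lane on the crux `K1LocalisedCascade` (stmt-AnomalousDissipation-19491), route
`SawtoothPulseCascade`, registered line `Cruxes.K1LocalisedCascade.Spectral` (one open stub `stub_highModeConcentration`).
Channel (Z) of the analytic first good piece (memo v8 §1): the inviscid iterate `a_{i₀} = datum ∘ Ψ` is an exact (up to the
slope defect) windowed plane wave off the ZONE-VISITOR set `V_{i₀}` — the points whose backward trajectory meets a corner zone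
of some `U_j` at some half-stage.  Along the recursion `a ↦ a ∘ shearMap i j (γ•U_j)` the bad set propagates as
`Bad' ⊆ (shearMap i j (γ•U_j))⁻¹(Bad) ∪ {x : x_j ∈ Z}` (`Z ⊆ 𝕋` the zone of the stage), and since the shear preserves volume and
the strip `{x_j ∈ Z}` has the volume of `Z`:

* §1 `volume_strip_eq`, `volume_preimage_union_strip_le` — `vol((shearMap i j φ)⁻¹ B ∪ {x_l ∈ Z}) ≤ vol B + vol Z`;
  `volume_badSet_le_sum` — for ANY family `Bad : ℕ → Set 𝕋²` with `Bad 0 = ∅` and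
  `Bad (m+1) ⊆ (shearMap (i m) (j m) (φ m))⁻¹(Bad m) ∪ {x_{l m} ∈ Z m}`: `vol(Bad n) ≤ Σ_{m<n} vol(Z m)`;
* §2 `volume_slopeZone_le` — the corner zone of `U_j` read on the circle, `{b : 2e^{−M²/2} < |U_j′(b) ∓ 1|}`, has volume `≤ 4Mδ_j/π`
  (`…K1Flat.volume_zone_le'` transferred by `AddCircle.add_projection_respects_measure`);
* §3 `volume_badSet_cascade_le` — for the cascade's half-stages (strip coordinate `1` on H, `0` on V, zones of depth `M j`):
  `vol(Bad (2n)) ≤ Σ_{j<n} 8 M_j δ_j/π`.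

WHAT THIS IS NOT: the zone-visitor sets themselves are not defined here (they come with the cellwise representation of the iterate);
any family with the stated recursion inclusions is covered. [cite: ElgindiLissMattingly2025, §1 (corner strips of the alternating shears)]
[problem: turb]
-/

-- `Summit.<Summit>.<Problem>`: single-conjunct summit, the duplicate namespace segment is deliberate.
set_option linter.dupNamespace false

noncomputable section

namespace Summit.AnomalousDissipation.AnomalousDissipation.Theorems.SawtoothPulseCascade.K1Start

open MeasureTheory Set Filter Topology UnitAddTorus Function
open scoped ENNReal
open Literature.Analysis Literature.Analysis.FunctionSpaces Literature.Analysis.FunctionSpaces.Torus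
open Literature.Analysis.FluidPDE.ShearStage
open Literature.Analysis.FluidPDE.SawtoothCascade Literature.Analysis.FluidPDE.SawtoothCascade.CascadeParams

/-! ## §1 Strips, shears and the bad-set recursion -/

section Abstract

/-- A coordinate strip `{x : x_l ∈ Z}` of `𝕋²` has the volume of `Z ⊆ 𝕋` (the coordinate map is measure preserving). [folklore] -/
theorem volume_strip_eq (l : Fin 2) {Z : Set UnitAddCircle} (hZ : MeasurableSet Z) :
    volume {x : UnitAddTorus (Fin 2) | x l ∈ Z} = volume Z := by
  have hev : MeasurePreserving (fun x : UnitAddTorus (Fin 2) => x l) volume volume :=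
    measurePreserving_eval (fun _ : Fin 2 => (volume : Measure UnitAddCircle)) l
  exact hev.measure_preimage hZ.nullMeasurableSet

/-- **One stage of the recursion**: `vol((shearMap i j φ)⁻¹ B ∪ {x_l ∈ Z}) ≤ vol B + vol Z` (`i ≠ j`; the shear preserves volume).
[folklore] -/
theorem volume_preimage_union_strip_le {i j : Fin 2} (hij : i ≠ j) (Q : ShearProfile) {B : Set (UnitAddTorus (Fin 2))}
    (hB : MeasurableSet B) (l : Fin 2) {Z : Set UnitAddCircle} (hZ : MeasurableSet Z) :
    volume (shearMap i j Q ⁻¹' B ∪ {x : UnitAddTorus (Fin 2) | x l ∈ Z}) ≤ volume B + volume Z := by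
  refine (measure_union_le _ _).trans ?_
  rw [(measurePreserving_shearMap hij Q).measure_preimage hB.nullMeasurableSet, volume_strip_eq l hZ]

/-- **The bad-set recursion.**  For stage shears `shearMap (i m) (j m) (φ m)` (`i m ≠ j m`), strip coordinates `l m`, measurable zones
`Z m ⊆ 𝕋` and measurable sets `Bad m ⊆ 𝕋²` with `Bad 0 = ∅` and `Bad (m+1) ⊆ (shearMap (i m) (j m) (φ m))⁻¹(Bad m) ∪ {x_{l m} ∈ Z m}`:
`vol(Bad n) ≤ Σ_{m<n} vol(Z m)`. [folklore] -/
theorem volume_badSet_le_sum (i j l : ℕ → Fin 2) (hij : ∀ m, i m ≠ j m) (φ : ℕ → ShearProfile)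
    (Z : ℕ → Set UnitAddCircle) (hZ : ∀ m, MeasurableSet (Z m)) (Bad : ℕ → Set (UnitAddTorus (Fin 2)))
    (hBad : ∀ m, MeasurableSet (Bad m)) (h0 : Bad 0 = ∅)
    (hrec : ∀ m, Bad (m + 1) ⊆ shearMap (i m) (j m) (φ m) ⁻¹' Bad m ∪ {x : UnitAddTorus (Fin 2) | x (l m) ∈ Z m}) (n : ℕ) :
    volume (Bad n) ≤ ∑ m ∈ Finset.range n, volume (Z m) := by
  induction n with
  | zero => simp [h0]
  | succ n ih =>
    calc volume (Bad (n + 1)) ≤ volume (shearMap (i n) (j n) (φ n) ⁻¹' Bad n ∪ {x : UnitAddTorus (Fin 2) | x (l n) ∈ Z n}) :=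
          measure_mono (hrec n)
      _ ≤ volume (Bad n) + volume (Z n) := volume_preimage_union_strip_le (hij n) (φ n) (hBad n) (l n) (hZ n)
      _ ≤ (∑ m ∈ Finset.range n, volume (Z m)) + volume (Z n) := add_le_add ih le_rfl
      _ = ∑ m ∈ Finset.range (n + 1), volume (Z m) := (Finset.sum_range_succ _ n).symm

end Abstract

/-! ## §2 The corner zone of the cascade profile, read on the circle -/

section Cascade

variable (P : CascadeParams)

/-- The corner zone of depth `M` of `U_j` read on the circle through the derivative profile `Q = U_j′`:
`{b : 2e^{−M²/2} < |Q(b) − 1| ∧ 2e^{−M²/2} < |Q(b) + 1|}` is measurable (indeed open). [folklore] -/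
theorem measurableSet_slopeZone (Q : ShearProfile) (η : ℝ) :
    MeasurableSet {b : UnitAddCircle | η < |Q.onCircle b - 1| ∧ η < |Q.onCircle b + 1|} := by
  have h1 : Continuous fun b => |Q.onCircle b - 1| := (Q.continuous_onCircle.sub continuous_const).abs
  have h2 : Continuous fun b => |Q.onCircle b + 1| := (Q.continuous_onCircle.add continuous_const).abs
  exact (measurableSet_lt measurable_const h1.measurable).inter (measurableSet_lt measurable_const h2.measurable)

/-- **Volume of the corner zone on the circle.**  For `Q = U_j′` (`δ_j > 0`, `N_j ≠ 0`), `M ≥ 1`, `Mδ_j ≤ π/2`: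
`vol{b ∈ 𝕋 : 2e^{−M²/2} < |Q(b) − 1| ∧ 2e^{−M²/2} < |Q(b) + 1|} ≤ 4Mδ_j/π` (`…K1Flat.volume_zone_le'` on `[0,1)`, transferred to the
circle through the fundamental domain `(0,1]`). [cite: ElgindiLissMattingly2025, §1 (corner strips)] -/
theorem volume_slopeZone_le {j : ℕ} (hδ : 0 < P.δ j) (hN : P.N j ≠ 0) (Q : ShearProfile) (hQ : ∀ y, Q y = deriv (P.U j) y)
    {M : ℝ} (hM : 1 ≤ M) (hMδ : M * P.δ j ≤ Real.pi / 2) :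
    volume {b : UnitAddCircle | 2 * Real.exp (-(M ^ 2 / 2)) < |Q.onCircle b - 1| ∧
        2 * Real.exp (-(M ^ 2 / 2)) < |Q.onCircle b + 1|} ≤ ENNReal.ofReal (4 * M * P.δ j / Real.pi) := by
  set η : ℝ := 2 * Real.exp (-(M ^ 2 / 2)) with hη
  set Zc : Set UnitAddCircle := {b : UnitAddCircle | η < |Q.onCircle b - 1| ∧ η < |Q.onCircle b + 1|} with hZc
  set Zr : Set ℝ := {y : ℝ | y ∈ Ico (0 : ℝ) 1 ∧ η < |deriv (P.U j) y - 1| ∧ η < |deriv (P.U j) y + 1|} with hZr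
  have hmeas : MeasurableSet Zc := measurableSet_slopeZone Q η
  -- read the circle set on the fundamental domain `(0,1]`
  have hproj := AddCircle.add_projection_respects_measure (T := (1 : ℝ)) 0 hmeas
  rw [zero_add] at hproj
  have hpre : (QuotientAddGroup.mk : ℝ → UnitAddCircle) ⁻¹' Zc ∩ Ioc (0 : ℝ) 1 ⊆ Zr ∪ {1} := by
    intro y hy
    obtain ⟨hyZ, hy0, hy1⟩ := hy
    simp only [mem_preimage, hZc, mem_setOf_eq] at hyZ
    have e : Q.onCircle ((y : ℝ) : UnitAddCircle) = deriv (P.U j) y := by rw [ShearProfile.onCircle_coe, hQ]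
    rw [e] at hyZ
    rcases hy1.lt_or_eq with hlt | heq
    · exact Or.inl ⟨⟨hy0.le, hlt⟩, hyZ.1, hyZ.2⟩
    · exact Or.inr heq
  have hvol := K1Flat.volume_zone_le' P hδ hN hM hMδ
  calc volume Zc = volume ((QuotientAddGroup.mk : ℝ → UnitAddCircle) ⁻¹' Zc ∩ Ioc (0 : ℝ) 1) := hproj
    _ ≤ volume (Zr ∪ {1}) := measure_mono hpre
    _ ≤ volume Zr + volume ({1} : Set ℝ) := measure_union_le _ _
    _ = volume Zr := by rw [Real.volume_singleton, add_zero]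
    _ ≤ ENNReal.ofReal (4 * M * P.δ j / Real.pi) := hvol

/-! ## §3 The cascade's half-stages: `vol(Bad) ≤ Σ_j 8 M_j δ_j / π` -/

/-- **Zone-visitor measure along the cascade.**  Let `Bad : ℕ → Set 𝕋²` be measurable with `Bad 0 = ∅` and, for every phase `j`
(half-stages `2j` = H with strip coordinate `1`, `2j+1` = V with strip coordinate `0`; `Q j = U_j′`; zone depth `M j ≥ 1` with
`M_j δ_j ≤ π/2`):
`Bad (2j+1) ⊆ (shearMap 0 1 (γ•U_j))⁻¹(Bad (2j)) ∪ {x₁ ∈ Z_j}`, `Bad (2j+2) ⊆ (shearMap 1 0 (γ•U_j))⁻¹(Bad (2j+1)) ∪ {x₀ ∈ Z_j}`,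
`Z_j = {b : 2e^{−M_j²/2} < |U_j′(b) ∓ 1|}`.  Then `vol(Bad (2n)) ≤ Σ_{j<n} 8 M_j δ_j/π` (`δ₀ > 0`, `d > 0`, `N₀ ≥ 1`, `ρN ≥ 1`).
[cite: ElgindiLissMattingly2025, §1 (corner strips)] -/
theorem volume_badSet_cascade_le (hδ₀ : 0 < P.δ₀) (hd : 0 < P.d) (hN₀ : 1 ≤ P.N₀) (hρ : 1 ≤ P.ρN)
    (Q : ℕ → ShearProfile) (hQ : ∀ j y, Q j y = deriv (P.U j) y) (M : ℕ → ℝ) (hM : ∀ j, 1 ≤ M j)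
    (hMδ : ∀ j, M j * P.δ j ≤ Real.pi / 2) (Bad : ℕ → Set (UnitAddTorus (Fin 2))) (hBad : ∀ m, MeasurableSet (Bad m))
    (h0 : Bad 0 = ∅)
    (hH : ∀ j, Bad (2 * j + 1) ⊆ shearMap 0 1 (amp ⟨P.U j, P.U_periodic j, P.contDiff_U (P.δ_pos hδ₀ hd j)⟩ P.γ) ⁻¹' Bad (2 * j) ∪
      {x : UnitAddTorus (Fin 2) | x 1 ∈ {b : UnitAddCircle | 2 * Real.exp (-(M j ^ 2 / 2)) < |(Q j).onCircle b - 1| ∧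
        2 * Real.exp (-(M j ^ 2 / 2)) < |(Q j).onCircle b + 1|}})
    (hV : ∀ j, Bad (2 * j + 2) ⊆ shearMap 1 0 (amp ⟨P.U j, P.U_periodic j, P.contDiff_U (P.δ_pos hδ₀ hd j)⟩ P.γ) ⁻¹' Bad (2 * j + 1) ∪
      {x : UnitAddTorus (Fin 2) | x 0 ∈ {b : UnitAddCircle | 2 * Real.exp (-(M j ^ 2 / 2)) < |(Q j).onCircle b - 1| ∧
        2 * Real.exp (-(M j ^ 2 / 2)) < |(Q j).onCircle b + 1|}})
    (n : ℕ) :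
    volume (Bad (2 * n)) ≤ ∑ j ∈ Finset.range n, ENNReal.ofReal (8 * M j * P.δ j / Real.pi) := by
  -- the half-stage data
  set Zc : ℕ → Set UnitAddCircle := fun j => {b : UnitAddCircle | 2 * Real.exp (-(M j ^ 2 / 2)) < |(Q j).onCircle b - 1| ∧
    2 * Real.exp (-(M j ^ 2 / 2)) < |(Q j).onCircle b + 1|} with hZc
  have hZm : ∀ j, MeasurableSet (Zc j) := fun j => measurableSet_slopeZone (Q j) _
  have hZv : ∀ j, volume (Zc j) ≤ ENNReal.ofReal (4 * M j * P.δ j / Real.pi) := fun j =>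
    volume_slopeZone_le P (P.δ_pos hδ₀ hd j) (P.N_pos hN₀ hρ j).ne' (Q j) (hQ j) (hM j) (hMδ j)
  -- one phase = two half-stages
  have hphase : ∀ j, volume (Bad (2 * j + 2)) ≤ volume (Bad (2 * j)) + ENNReal.ofReal (8 * M j * P.δ j / Real.pi) := by
    intro j
    have h1 : volume (Bad (2 * j + 1)) ≤ volume (Bad (2 * j)) + volume (Zc j) :=
      (measure_mono (hH j)).trans (volume_preimage_union_strip_le (by decide) _ (hBad _) 1 (hZm j))
    have h2 : volume (Bad (2 * j + 2)) ≤ volume (Bad (2 * j + 1)) + volume (Zc j) :=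
      (measure_mono (hV j)).trans (volume_preimage_union_strip_le (by decide) _ (hBad _) 0 (hZm j))
    have h8 : ENNReal.ofReal (8 * M j * P.δ j / Real.pi) =
        ENNReal.ofReal (4 * M j * P.δ j / Real.pi) + ENNReal.ofReal (4 * M j * P.δ j / Real.pi) := by
      rw [← ENNReal.ofReal_add (by have := Real.pi_pos; have := hM j; have := P.δ_pos hδ₀ hd j; positivity)
        (by have := Real.pi_pos; have := hM j; have := P.δ_pos hδ₀ hd j; positivity)]
      congr 1; ring
    calc volume (Bad (2 * j + 2)) ≤ volume (Bad (2 * j + 1)) + volume (Zc j) := h2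
      _ ≤ (volume (Bad (2 * j)) + volume (Zc j)) + volume (Zc j) := add_le_add h1 le_rfl
      _ ≤ volume (Bad (2 * j)) + ENNReal.ofReal (8 * M j * P.δ j / Real.pi) := by
          rw [h8, add_assoc]; exact add_le_add le_rfl (add_le_add (hZv j) (hZv j))
  induction n with
  | zero => simp [h0]
  | succ n ih =>
    rw [Finset.sum_range_succ, show 2 * (n + 1) = 2 * n + 2 by ring]
    exact (hphase n).trans (add_le_add ih le_rfl)

end Cascade

end Summit.AnomalousDissipation.AnomalousDissipation.Theorems.SawtoothPulseCascade.K1Start
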